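import Literature.Computability.AlgebraicComplexity.KIReductionBricks
import HarnessLib

/-!
# Kabanets–Impagliazzo, Cor. 12: the reduction machine, II — input layers and uses

Sixth file of the discharge of the reduction fact
`Literature.Computability.AlgebraicComplexity.permanent01Graph_polyExists_preimage_PIT`
(`PermanentGraphNSUBEXP.lean`), continuing `KIReductionBricks.lean`. A USE of a guessed gate list
(`useGates base L B`, `KIReductionInstance.lean`) is a guard gate, the `n²` gates of the input
layer `L`, and the block. This file writes the layers and assembles uses:

* `lgF op` — the frame of the layer gate `1 • u` around an operand code computed by `op`;
* `layerF op ⟨U, prm⟩` — the DOUBLE fold over rows `a < n` and columns `b < n` (`n = |U|`) of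
  `lgF op`, and **`layerF_apply`**: it writes `encList` of the codes of the layer gates
  `layerGate (L k)`, `k = a·n + b`, whenever `op` writes the operand codes of `L` entrywise;
* the three operand pieces: `idOpF` (the identity layer `x_k`), `minorOpF` (the minor layer of
  level `i`, column `j`, parameters `⟨1^{i-1}, 1^j⟩`: Kabanets–Impagliazzo's `Xⱼ`), `constOpF`
  (the constant layer of the parsed input matrix, parameter the rows field of the input), with
  their values `idOpF_apply`, `minorOpF_apply`, `constOpF_apply`;
* `useF op ⟨⟨bin (b+1), Bs⟩, ⟨U, prm⟩⟩ = encList (codes of useGates b L (readBlock Bs))`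
  (**`useF_apply`**), with the structural length bound `length_useF_le`.

## References

* V. Kabanets, R. Impagliazzo, *Derandomizing polynomial identity tests means proving circuit
  lower bounds*, STOC 2003, Lemma 11 and proof of Cor. 12 (p. 358).
* S. Arora, B. Barak, *Computational Complexity: A Modern Approach*, CUP 2009, §1.3.
-/

noncomputable section

namespace Literature.Computability.AlgebraicComplexity

namespace KIReduction

open _root_.Computability Complexity Brick OracleCompose HashBricks Plumb Polynomial ArithCircuit

/-! ### `ccat` over a product of ranges; `ofFn` as a range map -/

/-- Splitting a concatenation (twin, outside this file's import cone:
`Barriers/CriticalPhenomena/GridSAWTowersEnumeration.lean`). [folklore] -/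
theorem ccat_add (g : ℕ → List Bool) (p : ℕ) : ∀ q, ccat g (p + q) = ccat g p ++ ccat (fun b => g (p + b)) q
  | 0 => by simp
  | q + 1 => by rw [Nat.add_succ, ccat_succ, ccat_add g p q, ccat_succ, List.append_assoc]

/-- **A double concatenation over rows and columns is a concatenation over positions `a·n + b`.** [folklore] -/
theorem ccat_ccat_eq (g : ℕ → List Bool) (n : ℕ) : ∀ m, ccat (fun a => ccat (fun b => g (a * n + b)) n) m = ccat g (m * n)
  | 0 => by simp
  | m + 1 => by rw [ccat_succ, ccat_ccat_eq g n m, Nat.succ_mul, ccat_add]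

/-- `List.ofFn` mapped, as a map over `List.range` of a totalised function. [folklore] -/
theorem map_ofFn_eq_map_range {α : Type} {N : ℕ} (f : Fin N → α) (F : ℕ → α) (h : ∀ k : Fin N, F k.val = f k) :
    (List.ofFn f) = (List.range N).map F := by
  apply List.ext_getElem (by simp)
  intro i h₁ h₂
  simp only [List.length_ofFn] at h₁
  simp [List.getElem_ofFn, h ⟨i, h₁⟩]

/-- `⟨c, w⟩ = ⟨c, ε⟩ ++ w`: a list code is the concatenation of the frames of its items (private copy of a
generic lemma held outside this file's import cone: `FarCertMachine.boolPair_eq_append`,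
`Algebra/EuclideanLattices/FarCertMachineCodes.lean`). [folklore] -/
private theorem boolPair_eq_frame_append (c w : List Bool) : boolPair c w = boolPair c [] ++ w := by
  simp [boolPair, List.append_assoc]

/-! ### The layer gate frame -/

/-- The code of a layer gate `1 • u` in terms of the operand code. [folklore] -/
theorem gateCode_layerGate (N : ℕ) (e : LayerEntry (Fin N)) :
    gateCode N (layerGate e) = false :: boolPair [true] (boolPair (boolPair (intCode 1) (opCode N e.toOperand)) []) := by
  rw [layerGate, gateCode_sum]; rfl

/-- **The layer gate frame** around an operand piece `op`: `⟨0 · ⟨1, ⟨⟨intCode 1, op ·⟩, ε⟩⟩, ε⟩`. [folklore] -/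
def lgF (op : List Bool → List Bool) : List Bool → List Bool :=
  frameF (List.cons false ∘ fanoutFn (fun _ => [true]) (fanoutFn (fanoutFn (fun _ => intCode 1) op) (fun _ => [])))

/-- `lgF op ∈ FP`. [folklore] -/
theorem lgF_mem_FP {op : List Bool → List Bool} (hop : op ∈ FP) : lgF op ∈ FP :=
  frameF_mem_FP (comp_mem_FP (cons_mem_FP false) (fanoutFn_mem_FP (const_mem_FP _)
    (fanoutFn_mem_FP (fanoutFn_mem_FP (const_mem_FP _) hop) (const_mem_FP _))))

/-- Value of the layer gate frame: the frame of the code of `1 • u` when `op` writes the code of `u`. [folklore] -/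
theorem lgF_apply {op : List Bool → List Bool} {z : List Bool} {N : ℕ} {e : LayerEntry (Fin N)}
    (h : op z = opCode N e.toOperand) : lgF op z = boolPair (gateCode N (layerGate e)) [] := by
  rw [gateCode_layerGate, lgF, frameF_apply]
  simp [h]

/-- Length of the layer gate frame: `4 |op z| + 64`. [folklore] -/
theorem length_lgF (op : List Bool → List Bool) (z : List Bool) : (lgF op z).length = 4 * (op z).length + 64 := by
  rw [lgF, length_frameF]
  simp only [Function.comp_apply, fanoutFn_apply, List.length_cons, length_boolPair, intCode_one, List.length_nil]
  ring

/-! ### The double fold of a layer -/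

/-- Accessors of the column-piece record `z = ⟨⟨⟨U, prm⟩, 1ᵃ⟩, 1ᵇ⟩`: the unary dimension `U`. [folklore] -/
def uOf : List Bool → List Bool := fstF ∘ fstF ∘ fstF
/-- The layer parameters `prm`. [folklore] -/
def prmOf : List Bool → List Bool := sndF ∘ fstF ∘ fstF
/-- The row index `1ᵃ`. [folklore] -/
def aOf : List Bool → List Bool := sndF ∘ fstF
/-- The column index `1ᵇ`. [folklore] -/
def bOf : List Bool → List Bool := sndF

/-- `uOf` on a record. [folklore] -/
@[simp] theorem uOf_rec (U prm A B : List Bool) : uOf (boolPair (boolPair (boolPair U prm) A) B) = U := by simp [uOf]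
/-- `prmOf` on a record. [folklore] -/
@[simp] theorem prmOf_rec (U prm A B : List Bool) : prmOf (boolPair (boolPair (boolPair U prm) A) B) = prm := by simp [prmOf]
/-- `aOf` on a record. [folklore] -/
@[simp] theorem aOf_rec (U prm A B : List Bool) : aOf (boolPair (boolPair (boolPair U prm) A) B) = A := by simp [aOf]
/-- `bOf` on a record. [folklore] -/
@[simp] theorem bOf_rec (U prm A B : List Bool) : bOf (boolPair (boolPair (boolPair U prm) A) B) = B := by simp [bOf]

/-- `uOf ∈ FP`. [folklore] -/
theorem uOf_mem_FP : uOf ∈ FP := comp_mem_FP fstF_mem_FP (comp_mem_FP fstF_mem_FP fstF_mem_FP)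
/-- `prmOf ∈ FP`. [folklore] -/
theorem prmOf_mem_FP : prmOf ∈ FP := comp_mem_FP sndF_mem_FP (comp_mem_FP fstF_mem_FP fstF_mem_FP)
/-- `aOf ∈ FP`. [folklore] -/
theorem aOf_mem_FP : aOf ∈ FP := comp_mem_FP sndF_mem_FP fstF_mem_FP
/-- `bOf ∈ FP`. [folklore] -/
theorem bOf_mem_FP : bOf ∈ FP := sndF_mem_FP

/-- Clip polynomial of the column fold (pieces are layer gate frames, `≤ 8 |x|² + 96`). [folklore] -/
def colQ : Polynomial ℕ := 8 * X ^ 2 + 96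

/-- Clip polynomial of the row fold (pieces are whole rows). [folklore] -/
def rowQ : Polynomial ℕ := 200 * X ^ 3 + 128 * X

/-- **The row piece** on `⟨⟨U, prm⟩, 1ᵃ⟩`: the column fold of `lgF op` over `|U|` rounds. [folklore] -/
def rowPieceF (op : List Bool → List Bool) : List Bool → List Bool :=
  foldCat colQ X (lgF op) ∘ fanoutFn id (fstF ∘ fstF)

/-- **The layer brick** on `⟨U, prm⟩`: the row fold of the row pieces over `|U|` rounds. [cite: KabanetsImpagliazzo2003, proof of Cor. 12 (p. 358)] -/
def layerF (op : List Bool → List Bool) : List Bool → List Bool :=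
  foldCat rowQ X (rowPieceF op) ∘ fanoutFn id fstF

/-- `rowPieceF op ∈ FP`. [folklore] -/
theorem rowPieceF_mem_FP {op : List Bool → List Bool} (hop : op ∈ FP) : rowPieceF op ∈ FP :=
  comp_mem_FP (foldCat_mem_FP _ _ (lgF_mem_FP hop)) (fanoutFn_mem_FP id_mem_FP (comp_mem_FP fstF_mem_FP fstF_mem_FP))

/-- `layerF op ∈ FP`. [folklore] -/
theorem layerF_mem_FP {op : List Bool → List Bool} (hop : op ∈ FP) : layerF op ∈ FP :=
  comp_mem_FP (foldCat_mem_FP _ _ (rowPieceF_mem_FP hop)) (fanoutFn_mem_FP id_mem_FP fstF_mem_FP)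

/-- An operand piece is ADMISSIBLE if its outputs on the column records in range are short:
`≤ 2 |U|² + 8` symbols. [folklore] -/
def OpShort (op : List Bool → List Bool) (U prm : List Bool) : Prop :=
  ∀ a b, a < U.length → b < U.length →
    (op (boolPair (boolPair (boolPair U prm) (ones a)) (ones b))).length ≤ 2 * U.length ^ 2 + 8

/-- Value of the row piece: the concatenation of the column frames. [folklore] -/
theorem rowPieceF_apply {op : List Bool → List Bool} {U prm : List Bool} (hs : OpShort op U prm) {a : ℕ} (ha : a < U.length) :
    rowPieceF op (boolPair (boolPair U prm) (ones a)) =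
      ccat (fun b => lgF op (boolPair (boolPair (boolPair U prm) (ones a)) (ones b))) U.length := by
  rw [rowPieceF, Function.comp_apply, fanoutFn_apply, id, Function.comp_apply, fstF_boolPair, fstF_boolPair]
  have hx : U.length ≤ (boolPair (boolPair U prm) (ones a)).length := by
    simp only [length_boolPair, ones, List.length_replicate]; omega
  refine foldCat_apply (p := X) (by simpa using hx) fun b hb => ?_
  rw [length_lgF]
  have h := hs a b ha hb
  simp only [colQ, Polynomial.eval_add, Polynomial.eval_mul, Polynomial.eval_ofNat, Polynomial.eval_pow,
    Polynomial.eval_X]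
  nlinarith [Nat.pow_le_pow_left hx 2]

/-- Length of the row piece: `≤ |U| · (8 |x|² + 96)`, `x` its record. [folklore] -/
theorem length_rowPieceF_le {op : List Bool → List Bool} {U prm : List Bool} (hs : OpShort op U prm) {a : ℕ} (ha : a < U.length) :
    (rowPieceF op (boolPair (boolPair U prm) (ones a))).length ≤
      U.length * (8 * (boolPair (boolPair U prm) (ones a)).length ^ 2 + 96) := by
  rw [rowPieceF_apply hs ha]
  refine length_ccat_le' U.length fun b hb => ?_
  rw [length_lgF]
  have h := hs a b ha hb
  have hx : U.length ≤ (boolPair (boolPair U prm) (ones a)).length := by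
    simp only [length_boolPair, ones, List.length_replicate]; omega
  nlinarith [Nat.pow_le_pow_left hx 2]

/-- **Value of the layer brick**: if `op` writes, at the column record of `(a, b)`, the operand
code of the entry `L (a·n + b)` of a layer `L` (`n = |U|`), then `layerF op ⟨U, prm⟩` is the list
code of the codes of the layer gates `layerGate (L k)`, `k < n²`. [cite: KabanetsImpagliazzo2003, proof of Cor. 12 (p. 358)] -/
theorem layerF_apply {op : List Bool → List Bool} {U prm : List Bool} (hs : OpShort op U prm)
    {L : Fin (U.length * U.length) → LayerEntry (Fin (U.length * U.length))}
    (hop : ∀ a b (ha : a < U.length) (hb : b < U.length),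
      op (boolPair (boolPair (boolPair U prm) (ones a)) (ones b)) =
        opCode (U.length * U.length) (L ⟨a * U.length + b, idx_lt ha hb⟩).toOperand) :
    layerF op (boolPair U prm) =
      encList ((List.ofFn fun k => layerGate (L k)).map (gateCode (U.length * U.length))) := by
  classical
  -- the totalised code of position `k`
  let G : ℕ → List Bool := fun k =>
    if h : k < U.length * U.length then gateCode (U.length * U.length) (layerGate (L ⟨k, h⟩)) else []
  have hU : U.length ≤ (boolPair U prm).length := by simp only [length_boolPair]; omega
  rw [layerF, Function.comp_apply, fanoutFn_apply, id, fstF_boolPair]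
  rw [foldCat_apply (p := X) (by simpa using hU) (fun a ha => ?_)]
  · have hrow : ∀ a, a < U.length → rowPieceF op (boolPair (boolPair U prm) (ones a)) =
        ccat (fun b => boolPair (G (a * U.length + b)) []) U.length := by
      intro a ha
      rw [rowPieceF_apply hs ha]
      refine ccat_congr fun b hb => ?_
      have hk : a * U.length + b < U.length * U.length := idx_lt ha hb
      rw [lgF_apply (hop a b ha hb)]
      simp only [G, dif_pos hk]
    rw [ccat_congr hrow, ccat_ccat_eq (fun k => boolPair (G k) []) U.length U.length, ccat_frame_eq_encList,
      List.map_ofFn]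
    congr 1
    refine (map_ofFn_eq_map_range _ G fun k => ?_).symm
    simp only [G, Function.comp_apply, dif_pos k.isLt]
  · refine (length_rowPieceF_le hs ha).trans ?_
    have hx : (boolPair (boolPair U prm) (ones a)).length ≤ 3 * (boolPair U prm).length + 2 := by
      simp only [length_boolPair, ones, List.length_replicate] at hU ⊢
      omega
    simp only [rowQ, Polynomial.eval_add, Polynomial.eval_mul, Polynomial.eval_ofNat, Polynomial.eval_pow,
      Polynomial.eval_X]
    set x := (boolPair U prm).length
    calc U.length * (8 * (boolPair (boolPair U prm) (ones a)).length ^ 2 + 96)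
        ≤ x * (8 * (3 * x + 2) ^ 2 + 96) := Nat.mul_le_mul hU (by nlinarith [Nat.pow_le_pow_left hx 2])
      _ = 72 * x ^ 3 + 96 * x ^ 2 + 128 * x := by ring
      _ ≤ 200 * x ^ 3 + 128 * x := by nlinarith [Nat.zero_le x, sq_nonneg x]

/-- Length of the layer code: `≤ |U| · rowQ (|⟨U, prm⟩|)`. [folklore] -/
theorem length_layerF_le {op : List Bool → List Bool} {U prm : List Bool} (hs : OpShort op U prm) :
    (layerF op (boolPair U prm)).length ≤ U.length * rowQ.eval (boolPair U prm).length := by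
  rw [layerF, Function.comp_apply, fanoutFn_apply, id, fstF_boolPair]
  have hQ : ∀ a, a < U.length → (rowPieceF op (boolPair (boolPair U prm) (ones a))).length ≤ rowQ.eval (boolPair U prm).length := by
    intro a ha
    refine (length_rowPieceF_le hs ha).trans ?_
    have hU : U.length ≤ (boolPair U prm).length := by simp only [length_boolPair]; omega
    have hx : (boolPair (boolPair U prm) (ones a)).length ≤ 3 * (boolPair U prm).length + 2 := by
      simp only [length_boolPair, ones, List.length_replicate] at hU ⊢
      omega
    simp only [rowQ, Polynomial.eval_add, Polynomial.eval_mul, Polynomial.eval_ofNat, Polynomial.eval_pow,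
      Polynomial.eval_X]
    set x := (boolPair U prm).length
    calc U.length * (8 * (boolPair (boolPair U prm) (ones a)).length ^ 2 + 96)
        ≤ x * (8 * (3 * x + 2) ^ 2 + 96) := Nat.mul_le_mul hU (by nlinarith [Nat.pow_le_pow_left hx 2])
      _ = 72 * x ^ 3 + 96 * x ^ 2 + 128 * x := by ring
      _ ≤ 200 * x ^ 3 + 128 * x := by nlinarith [Nat.zero_le x, sq_nonneg x]
  have hU : U.length ≤ (boolPair U prm).length := by simp only [length_boolPair]; omega
  rw [foldCat_apply (p := X) (by simpa using hU) hQ]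
  exact length_ccat_le' U.length hQ

/-! ### The three operand pieces -/

/-- **The identity-layer operand piece**: `00 · bin (a·n + b)`, the variable `x_{a·n+b}`. [cite: KabanetsImpagliazzo2003, Lemma 11 (p. 358)] -/
def idOpF : List Bool → List Bool :=
  List.cons false ∘ List.cons false ∘ lenBinF ∘ (fun z => (umulFn ∘ fanoutFn aOf uOf) z ++ bOf z)

/-- `idOpF ∈ FP`. [folklore] -/
theorem idOpF_mem_FP : idOpF ∈ FP :=
  comp_mem_FP (cons_mem_FP false) (comp_mem_FP (cons_mem_FP false) (comp_mem_FP lenBinF_mem_FP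
    (append_mem_FP (comp_mem_FP umulFn_mem_FP (fanoutFn_mem_FP aOf_mem_FP uOf_mem_FP)) bOf_mem_FP)))

/-- `idOpF` spelled out on a column record. [folklore] -/
theorem idOpF_rec (U prm : List Bool) (a b : ℕ) :
    idOpF (boolPair (boolPair (boolPair U prm) (ones a)) (ones b)) = false :: false :: encodeNat (a * U.length + b) := by
  have h : umulFn (boolPair (ones a) U) = ones (a * U.length) := by
    rw [umulFn_apply]; simp [ones]
  simp [idOpF, h, ones]

/-- Value of the identity-layer piece: the code of `x_{a·n+b}`. [folklore] -/
theorem idOpF_apply (U prm : List Bool) {a b : ℕ} (ha : a < U.length) (hb : b < U.length) :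
    idOpF (boolPair (boolPair (boolPair U prm) (ones a)) (ones b)) =
      opCode (U.length * U.length) (idL U.length ⟨a * U.length + b, idx_lt ha hb⟩).toOperand := by
  rw [idOpF_rec]; rfl

/-- The identity-layer piece is admissible. [folklore] -/
theorem opShort_idOpF (U prm : List Bool) : OpShort idOpF U prm := by
  intro a b ha hb
  rw [idOpF_rec]
  simp only [List.length_cons]
  have h1 := length_encodeNat_le_self (a * U.length + b)
  have h2 : a * U.length + b < U.length * U.length := idx_lt ha hb
  nlinarith

/-- **The minor-layer operand piece** (parameters `prm = ⟨1^{i-1}, 1ʲ⟩`): in the range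
`a, b < i − 1` the variable `x_{(a+1)·n + b'}`, `b' = b` for `b < j` and `b + 1` otherwise; `0`
elsewhere — Kabanets–Impagliazzo's minor `Xⱼ` (row `0` and column `j` deleted). [cite: KabanetsImpagliazzo2003, Lemma 11 (2) (p. 358)] -/
def minorOpF : List Bool → List Bool :=
  iteFn (andFn (ltLenF ∘ fanoutFn aOf (fstF ∘ prmOf)) (ltLenF ∘ fanoutFn bOf (fstF ∘ prmOf)))
    (List.cons false ∘ List.cons false ∘ lenBinF ∘
      (fun z => (umulFn ∘ fanoutFn (List.cons true ∘ aOf) uOf) z ++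
        iteFn (ltLenF ∘ fanoutFn bOf (sndF ∘ prmOf)) bOf (List.cons true ∘ bOf) z))
    (fun _ => zeroOpCode)

/-- `minorOpF ∈ FP`. [folklore] -/
theorem minorOpF_mem_FP : minorOpF ∈ FP :=
  iteFn_mem_FP
    (andFn_mem_FP (comp_mem_FP ltLenF_mem_FP (fanoutFn_mem_FP aOf_mem_FP (comp_mem_FP fstF_mem_FP prmOf_mem_FP)))
      (comp_mem_FP ltLenF_mem_FP (fanoutFn_mem_FP bOf_mem_FP (comp_mem_FP fstF_mem_FP prmOf_mem_FP))))
    (comp_mem_FP (cons_mem_FP false) (comp_mem_FP (cons_mem_FP false) (comp_mem_FP lenBinF_mem_FP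
      (append_mem_FP (comp_mem_FP umulFn_mem_FP (fanoutFn_mem_FP (comp_mem_FP (cons_mem_FP true) aOf_mem_FP) uOf_mem_FP))
        (iteFn_mem_FP (comp_mem_FP ltLenF_mem_FP (fanoutFn_mem_FP bOf_mem_FP (comp_mem_FP sndF_mem_FP prmOf_mem_FP)))
          bOf_mem_FP (comp_mem_FP (cons_mem_FP true) bOf_mem_FP))))))
    (const_mem_FP _)

/-- `minorOpF` spelled out on a column record with parameters `⟨1^{i₁}, 1ʲ⟩`. [folklore] -/
theorem minorOpF_rec (U : List Bool) (i₁ j a b : ℕ) :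
    minorOpF (boolPair (boolPair (boolPair U (boolPair (ones i₁) (ones j))) (ones a)) (ones b)) =
      if a < i₁ ∧ b < i₁ then false :: false :: encodeNat ((a + 1) * U.length + (if b < j then b else b + 1))
      else zeroOpCode := by
  have hc : andFn (ltLenF ∘ fanoutFn aOf (fstF ∘ prmOf)) (ltLenF ∘ fanoutFn bOf (fstF ∘ prmOf))
      (boolPair (boolPair (boolPair U (boolPair (ones i₁) (ones j))) (ones a)) (ones b)) = [decide (a < i₁) && decide (b < i₁)] := by
    rw [andFn_apply (b := decide (a < i₁)) (b' := decide (b < i₁))] <;> simp [ones]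
  have hm : umulFn (boolPair (true :: ones a) U) = ones ((a + 1) * U.length) := by
    rw [umulFn_apply]; simp [ones]
  unfold minorOpF
  rw [iteFn_apply hc]
  by_cases h : a < i₁ ∧ b < i₁
  · rw [if_pos (by simp [h.1, h.2]), if_pos h]
    simp only [Function.comp_apply, fanoutFn_apply, aOf_rec, uOf_rec, hm]
    by_cases hbj : b < j
    · rw [iteFn_apply_true (by simp [ones, hbj]), if_pos hbj]; simp [ones]
    · rw [iteFn_apply_false (by simp [ones, hbj]), if_neg hbj]; simp [ones, Nat.add_assoc]
  · rw [if_neg (by simpa [not_and_or, Bool.and_eq_true] using h), if_neg h]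

/-- Value of the minor-layer piece (level `i₁ + 1`, column `j`, `a, b < n`): the operand code of
the entry `a·n + b` of `minorLayer n (i₁ + 1) j`. [folklore] -/
theorem minorOpF_apply (U : List Bool) (i₁ j : ℕ) {a b : ℕ} (ha : a < U.length) (hb : b < U.length) (hi : i₁ + 1 ≤ U.length) :
    minorOpF (boolPair (boolPair (boolPair U (boolPair (ones i₁) (ones j))) (ones a)) (ones b)) =
      opCode (U.length * U.length)
        (minorLayer U.length (i₁ + 1) j ⟨a * U.length + b, idx_lt ha hb⟩).toOperand := by
  rw [minorOpF_rec]
  simp only [minorLayer, idx_div hb, idx_mod hb, Nat.add_sub_cancel]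
  by_cases h : a < i₁ ∧ b < i₁
  · rw [if_pos h, if_pos h]
    have hlt : (a + 1) * U.length + (if b < j then b else b + 1) < U.length * U.length := by
      have : (if b < j then b else b + 1) < U.length := by split_ifs <;> omega
      exact idx_lt (by omega) this
    simp only [varEntry, dif_pos hlt, LayerEntry.toOperand, opCode_var]
  · rw [if_neg h, if_neg h]; rfl

/-- The minor-layer piece is admissible. [folklore] -/
theorem opShort_minorOpF (U : List Bool) (i₁ j : ℕ) (hi : i₁ + 1 ≤ U.length) :
    OpShort minorOpF U (boolPair (ones i₁) (ones j)) := by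
  intro a b ha hb
  rw [minorOpF_rec]
  split_ifs with h hbj
  · simp only [List.length_cons]
    have h1 := length_encodeNat_le_self ((a + 1) * U.length + b)
    have h2 : (a + 1) * U.length + b < U.length * U.length := idx_lt (by omega) hb
    nlinarith
  · simp only [List.length_cons]
    have h1 := length_encodeNat_le_self ((a + 1) * U.length + (b + 1))
    have h2 : (a + 1) * U.length + b < U.length * U.length := idx_lt (by omega) hb
    nlinarith
  · simp [zeroOpCode, intCode_zero]

/-- The entry string `(a, b)` of the rows field of an input: item `b` of the entries of row `a`
(row `a` = item `a`; its entries = its second component). [folklore] -/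
def entryStr (rows : List Bool) (a b : ℕ) : List Bool := fstF (sndF^[b] (sndF (fstF (sndF^[a] rows))))

/-- The parsed matrix of the rows field: entry `1` exactly where the entry string is the code
of `1`, entry `0` otherwise. [cite: KabanetsImpagliazzo2003, proof of Cor. 12 (p. 358)] -/
def parsedEntry (rows : List Bool) (a b : ℕ) : ℤ := if entryStr rows a b = intCode 1 then 1 else 0

/-- **The constant-layer operand piece** (parameter `prm = rows`): the code of the constant
`parsedEntry rows a b`. [cite: KabanetsImpagliazzo2003, proof of Cor. 12 (p. 358)] -/
def constOpF : List Bool → List Bool :=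
  List.cons false ∘ List.cons true ∘
    iteFn (eqPairFn ∘ fanoutFn (nthItemFn ∘ fanoutFn bOf (sndF ∘ nthItemFn ∘ fanoutFn aOf prmOf)) (fun _ => intCode 1))
      (fun _ => intCode 1) (fun _ => intCode 0)

/-- `constOpF ∈ FP`. [folklore] -/
theorem constOpF_mem_FP : constOpF ∈ FP :=
  comp_mem_FP (cons_mem_FP false) (comp_mem_FP (cons_mem_FP true)
    (iteFn_mem_FP (comp_mem_FP eqPairFn_mem_FP (fanoutFn_mem_FP
        (comp_mem_FP nthItemFn_mem_FP (fanoutFn_mem_FP bOf_mem_FP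
          (comp_mem_FP sndF_mem_FP (comp_mem_FP nthItemFn_mem_FP (fanoutFn_mem_FP aOf_mem_FP prmOf_mem_FP)))))
        (const_mem_FP _)))
      (const_mem_FP _) (const_mem_FP _)))

/-- `constOpF` spelled out on a column record. [folklore] -/
theorem constOpF_rec (U rows : List Bool) (a b : ℕ) :
    constOpF (boolPair (boolPair (boolPair U rows) (ones a)) (ones b)) = false :: true :: intCode (parsedEntry rows a b) := by
  unfold constOpF parsedEntry
  simp only [Function.comp_apply]
  rw [iteFn_apply (b := decide (entryStr rows a b = intCode 1))]
  · by_cases h : entryStr rows a b = intCode 1 <;> simp [h]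
  · simp [entryStr, nthItemFn_boolPair, ones, eqPairFn_boolPair]

/-- Value of the constant-layer piece (`a, b < n`): the operand code of the entry `a·n + b` of the
constant layer of the parsed matrix. [folklore] -/
theorem constOpF_apply (U rows : List Bool) {a b : ℕ} (ha : a < U.length) (hb : b < U.length) :
    constOpF (boolPair (boolPair (boolPair U rows) (ones a)) (ones b)) =
      opCode (U.length * U.length)
        (constLayer U.length (fun a' b' => parsedEntry rows a'.val b'.val) ⟨a * U.length + b, idx_lt ha hb⟩).toOperand := by
  rw [constOpF_rec]
  have hd : finDiv (⟨a * U.length + b, idx_lt ha hb⟩ : Fin (U.length * U.length)) = ⟨a, ha⟩ := finDiv_idx ⟨a, ha⟩ ⟨b, hb⟩ _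
  have hm : finMod (⟨a * U.length + b, idx_lt ha hb⟩ : Fin (U.length * U.length)) = ⟨b, hb⟩ := finMod_idx ⟨a, ha⟩ ⟨b, hb⟩ _
  simp only [constLayer, hd, hm, LayerEntry.toOperand, opCode_const]

/-- The constant-layer piece is admissible. [folklore] -/
theorem opShort_constOpF (U rows : List Bool) : OpShort constOpF U rows := by
  intro a b _ _
  rw [constOpF_rec]
  unfold parsedEntry
  split_ifs <;> simp [intCode_one, intCode_zero]

/-! ### Uses -/

/-- The frame of the code of the guard gate `sum []`. [folklore] -/
def guardFrame : List Bool := boolPair [false, false, true] []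

/-- The guard frame is the frame of the code of `sum []`. [folklore] -/
theorem guardFrame_eq (N : ℕ) : guardFrame = boolPair (gateCode N (.sum [])) [] := by
  rw [gateCode_sum]; rfl

/-- **The use brick** on `⟨⟨bin (b+1), Bs⟩, ⟨U, prm⟩⟩`: guard frame, layer, block. [cite: KabanetsImpagliazzo2003, proof of Cor. 12 (p. 358)] -/
def useF (op : List Bool → List Bool) : List Bool → List Bool :=
  fun uc => (guardFrame ++ (layerF op ∘ sndF) uc) ++ (blockCodeF ∘ fstF) uc

/-- `useF op ∈ FP`. [folklore] -/
theorem useF_mem_FP {op : List Bool → List Bool} (hop : op ∈ FP) : useF op ∈ FP :=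
  append_mem_FP (append_mem_FP (const_mem_FP _) (comp_mem_FP (layerF_mem_FP hop) sndF_mem_FP))
    (comp_mem_FP blockCodeF_mem_FP fstF_mem_FP)

/-- **Value of the use brick**: the list code of the codes of `useGates b L (readBlock Bs)`. [cite: KabanetsImpagliazzo2003, proof of Cor. 12 (p. 358)] -/
theorem useF_apply {op : List Bool → List Bool} {U prm : List Bool} (hs : OpShort op U prm)
    {L : Fin (U.length * U.length) → LayerEntry (Fin (U.length * U.length))}
    (hop : ∀ a b (ha : a < U.length) (hb : b < U.length),
      op (boolPair (boolPair (boolPair U prm) (ones a)) (ones b)) =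
        opCode (U.length * U.length) (L ⟨a * U.length + b, idx_lt ha hb⟩).toOperand)
    (b : ℕ) (Bs : List Bool) :
    useF op (boolPair (boolPair (encodeNat (b + 1)) Bs) (boolPair U prm)) =
      encList ((useGates b L (readBlock Bs)).map (gateCode (U.length * U.length))) := by
  simp only [useF, Function.comp_apply, sndF_boolPair, fstF_boolPair, useGates, List.map_cons, List.map_append,
    encList_cons, encList_append, layerF_apply hs hop, blockCodeF_apply (U.length * U.length) b Bs,
    guardFrame_eq (U.length * U.length)]
  rw [boolPair_eq_frame_append _ (encList _ ++ _), List.append_assoc]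

/-- Length of a use code: `≤ 8 + |U| · rowQ (|⟨U, prm⟩|) + |Bs| · (12 |⟨BIN, Bs⟩| + 202)`. [folklore] -/
theorem length_useF_le {op : List Bool → List Bool} {U prm : List Bool} (hs : OpShort op U prm) (b : ℕ) (Bs : List Bool) :
    (useF op (boolPair (boolPair (encodeNat (b + 1)) Bs) (boolPair U prm))).length ≤
      8 + U.length * rowQ.eval (boolPair U prm).length +
        Bs.length * (12 * (boolPair (encodeNat (b + 1)) Bs).length + 202) := by
  simp only [useF, Function.comp_apply, sndF_boolPair, fstF_boolPair, List.length_append]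
  have h1 := length_layerF_le hs
  have h2 := length_blockCodeF_le b Bs
  have h3 : guardFrame.length = 8 := rfl
  omega

end KIReduction

end Literature.Computability.AlgebraicComplexity

end
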